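import Mathlib
import Summits.ValiantsHypothesis.ValiantsHypothesis.Theorems.GrenetZeonPolySizeQPAlgebraResidualCorankOne
import HarnessLib

/-!
# Crux `GrenetZeon.PolySizeQPAlgebra` (stmt-ValiantsHypothesis-8064), line `vbp-slice-dealg` —
# the reduction of `…LocalReduction` with the local Hessian bound required ONLY at residual corank `≥ 2`

`…LocalReduction` (`corner_all_large_of_localHessianBound`) empties every point `(n, s)` of the `c = 1`
box from a good `(s+1)`-space with threshold `2sn` and the inlined, type-independent hypothesis
`LocalHessianBound n`: for every local piece `(R, φ, λ, A, F = λ(det A))` and every `p` with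
`det A(p) = 0` in `R`, `rank Hess F(p) ≤ 2·dim R·n`.  `…ResidualCorankOne` proves that bound, for every
`R`, at all points where some `(n-1)`-minor of `A(p)` is a unit, i.e. where the residual matrix
`φ(A(p))` has corank one.  This file records the resulting SMALLER remaining input, by name:

  `LocalHessianBound₂ n`: the same bound, but only at points `p` with `det A(p) = 0` in `R` AND all
  `(n-1)`-minors of `A(p)` in the maximal ideal (`φ(adj A(p)) = 0`: residual corank `≥ 2`).

* `localHessianBound_of_residualCorankTwo` — `LocalHessianBound₂ n → LocalHessianBound n` (case split
  at `p`; the corank-one case is `rank_hess0_transl_le_of_residual_ne_zero`).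
* `not_hasAlgDetRepr_perPoly_self_of_localHessianBound₂` — `LocalHessianBound₂ n` and a good `c`-space
  with `s < c`, threshold `≥ 2sn` give `¬ HasAlgDetRepr per_n n s`.
* `corner_all_large_of_localHessianBound₂` — the all-large-`n` column form for every fixed `s`.

Residual corank `≥ 2` means `A(p) ≃ diag(1_k, S)` over `R` with `S` a `q × q` matrix over `𝔪`, `q ≥ 2`,
`det S = 0`; the points with a unimodular kernel vector of `S` are also already covered
(`rank_hess0_transl_le_of_vecMul_eq_zero`).  HONEST FRAMING: bookkeeping of a conditional reduction; no
stub of the line is closed; VP ≠ VNP is not moved.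

References: T. Mignon, N. Ressayre, IMRN 2004:79, §2 [MignonRessayre2004].
-/

noncomputable section

open MvPolynomial Matrix
open Literature.Computability.AlgebraicComplexity

-- single-conjunct layout `Summits/ValiantsHypothesis/ValiantsHypothesis`: duplicated namespace by design
set_option linter.dupNamespace false

namespace Summit.ValiantsHypothesis.ValiantsHypothesis.Theorems.GrenetZeonPolySizeQPAlgebra

/-- **`LocalHessianBound₂ n → LocalHessianBound n`.**  If the local Hessian bound
`rank Hess F(p) ≤ 2·dim R·n` holds at all points of residual corank `≥ 2` (all `(n-1)`-minors of `A(p)`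
killed by the character `φ`), then it holds at every point with `det A(p) = 0` in `R`: at the other
points some `(n-1)`-minor of `A(p)` is a unit and `rank_hess0_transl_le_of_residual_ne_zero` applies.
[cite: MignonRessayre2004, §2] -/
theorem localHessianBound_of_residualCorankTwo {n : ℕ}
    (hH₂ : ∀ (R : Type) [CommRing R] [Algebra ℂ R] [Module.Finite ℂ R] (φ : R →ₐ[ℂ] ℂ) (ν : ℕ),
      RingHom.ker (φ : R →+* ℂ) ^ ν = ⊥ →
      ∀ (l : R →ₗ[ℂ] ℂ), (∀ r : R, (∀ x, l (x * r) = 0) → r = 0) →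
      ∀ (A : Matrix (Fin n) (Fin n) (MvPolynomial (Fin n × Fin n) R)) (F : MvPolynomial (Fin n × Fin n) ℂ),
        (∀ a b, (A a b).IsHomogeneous 1) → (∀ d, l (coeff d A.det) = coeff d F) →
        ∀ p : Fin n × Fin n → ℂ, eval (fun i => algebraMap ℂ R (p i)) A.det = 0 →
          (∀ i j, φ ((A.map (eval (fun i => algebraMap ℂ R (p i)))).adjugate i j) = 0) →
          (hess0 (transl p F)).rank ≤ 2 * Module.finrank ℂ R * n) :
    ∀ (R : Type) [CommRing R] [Algebra ℂ R] [Module.Finite ℂ R] (φ : R →ₐ[ℂ] ℂ) (ν : ℕ),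
      RingHom.ker (φ : R →+* ℂ) ^ ν = ⊥ →
      ∀ (l : R →ₗ[ℂ] ℂ), (∀ r : R, (∀ x, l (x * r) = 0) → r = 0) →
      ∀ (A : Matrix (Fin n) (Fin n) (MvPolynomial (Fin n × Fin n) R)) (F : MvPolynomial (Fin n × Fin n) ℂ),
        (∀ a b, (A a b).IsHomogeneous 1) → (∀ d, l (coeff d A.det) = coeff d F) →
        ∀ p : Fin n × Fin n → ℂ, eval (fun i => algebraMap ℂ R (p i)) A.det = 0 →
          (hess0 (transl p F)).rank ≤ 2 * Module.finrank ℂ R * n := by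
  intro R _ _ _ φ ν hker l hl A F hA hF p hp
  by_cases h : ∃ i j, φ ((A.map (eval (fun i => algebraMap ℂ R (p i)))).adjugate i j) ≠ 0
  · exact rank_hess0_transl_le_of_residual_ne_zero φ hker l A F
      (fun a b => (hA a b).totalDegree_le) hF p hp h
  · push Not at h
    exact hH₂ R φ ν hker l hl A F hA hF p hp h

/-- **Every point `(n, s)` from `LocalHessianBound₂ n` and a good `(s+1)`-space** (`…LocalReduction`
with the smaller input): a good `c`-space with `s < c` and threshold `t ≥ 2sn` at `n ≥ 1` excludes every
`(n, s)`-representation of `per_n`, provided the local Hessian bound holds at residual corank `≥ 2`.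
[cite: MignonRessayre2004, §2] -/
theorem not_hasAlgDetRepr_perPoly_self_of_localHessianBound₂ {n s c t : ℕ} (hn : 1 ≤ n)
    (hH₂ : ∀ (R : Type) [CommRing R] [Algebra ℂ R] [Module.Finite ℂ R] (φ : R →ₐ[ℂ] ℂ) (ν : ℕ),
      RingHom.ker (φ : R →+* ℂ) ^ ν = ⊥ →
      ∀ (l : R →ₗ[ℂ] ℂ), (∀ r : R, (∀ x, l (x * r) = 0) → r = 0) →
      ∀ (A : Matrix (Fin n) (Fin n) (MvPolynomial (Fin n × Fin n) R)) (F : MvPolynomial (Fin n × Fin n) ℂ),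
        (∀ a b, (A a b).IsHomogeneous 1) → (∀ d, l (coeff d A.det) = coeff d F) →
        ∀ p : Fin n × Fin n → ℂ, eval (fun i => algebraMap ℂ R (p i)) A.det = 0 →
          (∀ i j, φ ((A.map (eval (fun i => algebraMap ℂ R (p i)))).adjugate i j) = 0) →
          (hess0 (transl p F)).rank ≤ 2 * Module.finrank ℂ R * n)
    (hW : ∃ w : Fin c → (Fin n × Fin n → ℂ), LinearIndependent ℂ w ∧
      ∀ a : Fin c → ℂ, a ≠ 0 → eval (∑ i, a i • w i) (perPoly (Fin n) ℂ) = 0 →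
        t < (hess0 (transl (∑ i, a i • w i) (perPoly (Fin n) ℂ))).rank)
    (hsc : s < c) (ht : 2 * s * n ≤ t) : ¬ HasAlgDetRepr (perPoly (Fin n) ℂ) n s :=
  not_hasAlgDetRepr_perPoly_self_of_localHessianBound hn
    (localHessianBound_of_residualCorankTwo hH₂) hW hsc ht

/-- **All large `n`, every fixed `s`, from `LocalHessianBound₂`:** the residual-corank-`≥ 2` local
Hessian bound at every `n` and good `(s+1)`-spaces with threshold `2sn` for all large `n` empty the whole
column `(m, s') ≤ (n, s)` of the `c = 1` box for all large `n`. [folklore] -/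
theorem corner_all_large_of_localHessianBound₂ (s : ℕ)
    (hH₂ : ∀ n : ℕ, ∀ (R : Type) [CommRing R] [Algebra ℂ R] [Module.Finite ℂ R] (φ : R →ₐ[ℂ] ℂ) (ν : ℕ),
      RingHom.ker (φ : R →+* ℂ) ^ ν = ⊥ →
      ∀ (l : R →ₗ[ℂ] ℂ), (∀ r : R, (∀ x, l (x * r) = 0) → r = 0) →
      ∀ (A : Matrix (Fin n) (Fin n) (MvPolynomial (Fin n × Fin n) R)) (F : MvPolynomial (Fin n × Fin n) ℂ),
        (∀ a b, (A a b).IsHomogeneous 1) → (∀ d, l (coeff d A.det) = coeff d F) →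
        ∀ p : Fin n × Fin n → ℂ, eval (fun i => algebraMap ℂ R (p i)) A.det = 0 →
          (∀ i j, φ ((A.map (eval (fun i => algebraMap ℂ R (p i)))).adjugate i j) = 0) →
          (hess0 (transl p F)).rank ≤ 2 * Module.finrank ℂ R * n)
    (hW : ∃ n₀ : ℕ, ∀ n ≥ n₀, ∃ w : Fin (s + 1) → (Fin n × Fin n → ℂ), LinearIndependent ℂ w ∧
      ∀ a : Fin (s + 1) → ℂ, a ≠ 0 → eval (∑ i, a i • w i) (perPoly (Fin n) ℂ) = 0 →
        2 * s * n < (hess0 (transl (∑ i, a i • w i) (perPoly (Fin n) ℂ))).rank) :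
    ∃ n₀ : ℕ, ∀ n ≥ n₀, ∀ m s' : ℕ, m ≤ n → s' ≤ s → ¬ HasAlgDetRepr (perPoly (Fin n) ℂ) m s' :=
  corner_all_large_of_localHessianBound s (fun n => localHessianBound_of_residualCorankTwo (hH₂ n)) hW

end Summit.ValiantsHypothesis.ValiantsHypothesis.Theorems.GrenetZeonPolySizeQPAlgebra

end
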